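import Summits.QuantumFields.BalabanUV.Beta.CompositeHessianTable

/-!
# `BalabanUV.Beta.CompositeVertexKernelUnroll` — row D1 ∕ (C1), F6a′: **THE m-FOLD COMPOSITE VERTEX ∕ CONSTRAINT-HESSIAN KERNEL UNROLLED BY STOREY**

WHAT.  F3∕F6a define the composite kernels of an `m`-fold block averaging by the chain rule PEELED AT THE TOP step
(`CompositeVertexKernelRec.compVHKer_succ`, `rfl`): at depth `m+1` the top brick `𝓋 m` at its own slot along the two `compLinKer`-transported
finest bonds, PLUS the top linear brick `ℓ m` composed with the depth-`m` composite's kernel.  This file UNROLLS that recursion into the storey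
sum the road «FP» reads at the pass (R-FP-75, J-RISK-3′ — «owner an2: the composite Λ word's unfolding by storey through F3∕F6a's composition
letters»; the row's word W-4 of gen 59, journal `pub-balaban/CLAIMS.log` l.66570):
* [our object — bookkeeping] `storeyVH ℓ 𝓋 L k μ y f f′` — THE STOREY-`k` TERM: the step-`k` brick `𝓋 k` at its slot `(μ, y)` with BOTH finest bonds `f, f′` transported to
  level `k` by `compLinKer ℓ L k` (exactly the first summand of `compVHKer_succ k`);
* [our object — bookkeeping] `liftUp ℓ L k F n` — THE UPPER LINEAR LIFT of a level-`(k+1)` slot function `F` through the `n` steps ABOVE storey `k` (bricks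
  `ℓ (k+1), …, ℓ (k+n)`): `liftUp k F 0 = F`, `liftUp k F (n+1) μ y = Σ_{κ, e ∈ offs L} ℓ (k+1+n) μ y (κ, L•y+e) · liftUp k F n κ (L•y+e)` — the transport whose
  TRANSPOSE pulls a top multiplier covector back to storey `k`'s slots;
* [folklore] **`compVHKer_unroll`**: `compVHKer ℓ 𝓋 L m μ y f f′ = Σ_{k < m} liftUp ℓ L k (storeyVH ℓ 𝓋 L k · · f f′) (m − 1 − k) μ y` — ONE brick per storey, lifted to the top slot;
  **`compHessFF_unroll`**: the same for F6a's packed field–field table `compHessFF ℓ 𝒽 L m = packFF (compVHKer ℓ 𝒽 L m)`;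
  anchors `compVHKer_unroll_one` (depth one = the level-`0` storey term) and `liftUp_one`.
Pure finite-sum bookkeeping over the row's OWN typed objects (induction on `m`, `Finset.sum_comm`); brick-generic (any `ℓ`, `𝓋`, `L`), so it serves the rooted AND the
(0.4)-symmetrised instantiations of F3∕F6a alike.  WHAT THIS IS NOT: not the periodisation ∕ torus packing at the pass (the road's), not the identification with
leaf-05's companion family `onTowerFamily` (R-FP-75), not the adjoint (coefficient-side) form over INFINITE slot sums (needs the summability letters; not here);
nothing of Bałaban's asserted, valued or discharged; 0 estimates; 0∕4 row-D1 binders (hW ∕ hR ∕ `D1Tel` ∕ `D1Rep`); NOT (C1), NOT (T-ID), NOT D1, NEVER «G-an2-4 closed»,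
NOT BetaPertH, NOT continuum, NOT Clay.  Two [our object — bookkeeping] definitions (`storeyVH`, `liftUp`), no `def … : Prop`, nothing cited, 0 sorry.

HONEST DEPENDENCY (page 1, mandatory): continuum YM on T⁴ ⇐ BetaPertH ∧ nine spine estimates (0/9 proved); BetaPertH ⇐ (D1) ∧ (D4) ∧ CAP+tail;
G-an2-4 gates asym, D1 and NE2/3/4.  ABSOLUTE RULE (cell charter, verbatim): «No internally-minted statement may enter as a cited fact. Every hypothesis is
either kernel-proved in this package or a verbatim quotation of a PUBLISHED theorem with page reference.»  Row D1 ∕ (C1) OWNER an2, gen 59, 2026-08-25.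
No existing file touched.
-/

noncomputable section

open scoped BigOperators

namespace Summit.QuantumFields.BalabanUV.Beta.CompositeVertexKernelUnroll

open Finset
open Literature.MathematicalPhysics.QuantumFieldTheory.Balaban1983to89
open Literature.MathematicalPhysics.QuantumFieldTheory.Balaban1983to89.Beta
open AffineAveraging (Site)
open AveragingHessianKernels (Bond)
open ExpKernelCalculus (MKer)
open OneStepResolventKernel (Fib)
open Summit.QuantumFields.BalabanUV.Beta.CompositeVertexKernelRec (offs compLinKer compVHKer compVHKer_zero compVHKer_succ compLinKer_zero)
open Summit.QuantumFields.BalabanUV.Beta.CompositeHessianTable (packFF compHessFF)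

variable {d : ℕ}
variable (ℓ : ℕ → Fin (d + 1) → Site (d + 1) → Bond (d + 1) → ℝ)
  (𝓋 : ℕ → Fin (d + 1) → Site (d + 1) → Bond (d + 1) → Bond (d + 1) → ℝ) (L : ℕ)

/-! ## §1 The storey term and the upper lift -/

/-- [our object — bookkeeping] **THE STOREY-`k` TERM**: the step-`k` vertex brick at its own slot `(μ, y)`, both finest bonds transported to level `k` by the
depth-`k` composite linear kernel — the first summand of `compVHKer_succ k` verbatim. -/
def storeyVH (k : ℕ) (μ : Fin (d + 1)) (y : Site (d + 1)) (f f' : Bond (d + 1)) : ℝ :=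
  ∑ κ : Fin (d + 1), ∑ e ∈ offs L, ∑ κ' : Fin (d + 1), ∑ e' ∈ offs L,
    𝓋 k μ y (κ, (L : ℤ) • y + e) (κ', (L : ℤ) • y + e')
      * compLinKer ℓ L k f (κ, (L : ℤ) • y + e) * compLinKer ℓ L k f' (κ', (L : ℤ) • y + e')

/-- [our object — bookkeeping] **THE UPPER LINEAR LIFT** of a level-`(k+1)` slot function through the `n` steps above storey `k` (bricks `ℓ (k+1), …, ℓ (k+n)`,
each read on its window `L•y + offs L`). -/
def liftUp (k : ℕ) (F : Fin (d + 1) → Site (d + 1) → ℝ) : ℕ → Fin (d + 1) → Site (d + 1) → ℝ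
  | 0, μ, y => F μ y
  | n + 1, μ, y => ∑ κ : Fin (d + 1), ∑ e ∈ offs L, ℓ (k + 1 + n) μ y (κ, (L : ℤ) • y + e) * liftUp k F n κ ((L : ℤ) • y + e)

variable {ℓ 𝓋 L}

/-- [folklore] no step above: the lift is the function itself. -/
@[simp] theorem liftUp_zero (k : ℕ) (F : Fin (d + 1) → Site (d + 1) → ℝ) (μ : Fin (d + 1)) (y : Site (d + 1)) :
    liftUp ℓ L k F 0 μ y = F μ y := rfl

/-- [folklore] one more step above (by `rfl`). -/
theorem liftUp_succ (k : ℕ) (F : Fin (d + 1) → Site (d + 1) → ℝ) (n : ℕ) (μ : Fin (d + 1)) (y : Site (d + 1)) :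
    liftUp ℓ L k F (n + 1) μ y
      = ∑ κ : Fin (d + 1), ∑ e ∈ offs L, ℓ (k + 1 + n) μ y (κ, (L : ℤ) • y + e) * liftUp ℓ L k F n κ ((L : ℤ) • y + e) := rfl

/-- [folklore] one step above storey `k` is the brick `ℓ (k+1)` read on its window. -/
theorem liftUp_one (k : ℕ) (F : Fin (d + 1) → Site (d + 1) → ℝ) (μ : Fin (d + 1)) (y : Site (d + 1)) :
    liftUp ℓ L k F 1 μ y = ∑ κ : Fin (d + 1), ∑ e ∈ offs L, ℓ (k + 1) μ y (κ, (L : ℤ) • y + e) * F κ ((L : ℤ) • y + e) := by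
  rw [liftUp_succ]
  rfl

/-- [folklore] the lift is linear in the slot function: finite sums pass through. -/
theorem liftUp_finset_sum {ι : Type*} (s : Finset ι) (k : ℕ) (F : ι → Fin (d + 1) → Site (d + 1) → ℝ) (n : ℕ) (μ : Fin (d + 1)) (y : Site (d + 1)) :
    liftUp ℓ L k (fun μ' y' => ∑ i ∈ s, F i μ' y') n μ y = ∑ i ∈ s, liftUp ℓ L k (F i) n μ y := by
  induction n generalizing μ y with
  | zero => simp only [liftUp_zero]
  | succ n ih =>
      simp only [liftUp_succ, ih, Finset.mul_sum]
      simp_rw [Finset.sum_comm (s := offs L) (t := s)]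
      exact Finset.sum_comm

/-- [folklore] the storey term at depth `0` transports nothing: `storeyVH 0 μ y f f′ = Σ … 𝓋 0 μ y g g′ · [g = f] · [g′ = f′]` (by `rfl` on `compLinKer_zero`). -/
theorem storeyVH_zero (μ : Fin (d + 1)) (y : Site (d + 1)) (f f' : Bond (d + 1)) :
    storeyVH ℓ 𝓋 L 0 μ y f f'
      = ∑ κ : Fin (d + 1), ∑ e ∈ offs L, ∑ κ' : Fin (d + 1), ∑ e' ∈ offs L,
          𝓋 0 μ y (κ, (L : ℤ) • y + e) (κ', (L : ℤ) • y + e')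
            * (if ((κ, (L : ℤ) • y + e) : Bond (d + 1)) = f then (1 : ℝ) else 0)
            * (if ((κ', (L : ℤ) • y + e') : Bond (d + 1)) = f' then (1 : ℝ) else 0) := by
  simp only [storeyVH, compLinKer_zero]

/-! ## §2 The unrolling -/

/-- [folklore] **THE COMPOSITE VERTEX KERNEL UNROLLED BY STOREY**: `compVHKer ℓ 𝓋 L m μ y f f′ = Σ_{k < m} liftUp ℓ L k (storeyVH ℓ 𝓋 L k · · f f′) (m − 1 − k) μ y`
— one brick per storey `k < m` along the `compLinKer k`-transported bonds, lifted through the `m − 1 − k` steps above it to the top slot `(μ, y)`.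
Induction on `m` over `compVHKer_succ` (top peel) and `Finset.sum_comm`. -/
theorem compVHKer_unroll (m : ℕ) (μ : Fin (d + 1)) (y : Site (d + 1)) (f f' : Bond (d + 1)) :
    compVHKer ℓ 𝓋 L m μ y f f'
      = ∑ k ∈ range m, liftUp ℓ L k (fun μ' y' => storeyVH ℓ 𝓋 L k μ' y' f f') (m - 1 - k) μ y := by
  induction m generalizing μ y with
  | zero => simp only [compVHKer_zero, Finset.range_zero, Finset.sum_empty]
  | succ m ih =>
      rw [compVHKer_succ, Finset.sum_range_succ]
      have htop : liftUp ℓ L m (fun μ' y' => storeyVH ℓ 𝓋 L m μ' y' f f') (m + 1 - 1 - m) μ y = storeyVH ℓ 𝓋 L m μ y f f' := by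
        rw [show m + 1 - 1 - m = 0 by omega, liftUp_zero]
      rw [htop, add_comm]
      congr 1
      -- the lower storeys: peel the top linear brick into one more lift step
      calc (∑ κ : Fin (d + 1), ∑ e ∈ offs L, ℓ m μ y (κ, (L : ℤ) • y + e) * compVHKer ℓ 𝓋 L m κ ((L : ℤ) • y + e) f f')
          = ∑ κ : Fin (d + 1), ∑ e ∈ offs L, ∑ k ∈ range m,
              ℓ m μ y (κ, (L : ℤ) • y + e) * liftUp ℓ L k (fun μ' y' => storeyVH ℓ 𝓋 L k μ' y' f f') (m - 1 - k) κ ((L : ℤ) • y + e) := by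
            refine Finset.sum_congr rfl fun κ _ => Finset.sum_congr rfl fun e _ => ?_
            rw [ih, Finset.mul_sum]
        _ = ∑ k ∈ range m, ∑ κ : Fin (d + 1), ∑ e ∈ offs L,
              ℓ m μ y (κ, (L : ℤ) • y + e) * liftUp ℓ L k (fun μ' y' => storeyVH ℓ 𝓋 L k μ' y' f f') (m - 1 - k) κ ((L : ℤ) • y + e) := by
            simp_rw [Finset.sum_comm (s := offs L) (t := range m)]
            exact Finset.sum_comm
        _ = ∑ k ∈ range m, liftUp ℓ L k (fun μ' y' => storeyVH ℓ 𝓋 L k μ' y' f f') (m + 1 - 1 - k) μ y := by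
            refine Finset.sum_congr rfl fun k hk => ?_
            have hk' : k < m := Finset.mem_range.mp hk
            rw [show m + 1 - 1 - k = (m - 1 - k) + 1 by omega, liftUp_succ, show k + 1 + (m - 1 - k) = m by omega]

/-- [folklore] ANCHOR: at depth one the unrolled sum is the single level-`0` storey term. -/
theorem compVHKer_unroll_one (μ : Fin (d + 1)) (y : Site (d + 1)) (f f' : Bond (d + 1)) :
    compVHKer ℓ 𝓋 L 1 μ y f f' = storeyVH ℓ 𝓋 L 0 μ y f f' := by
  rw [compVHKer_unroll, Finset.sum_range_one, liftUp_zero]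

/-- [folklore] depth two, written out: the level-`1` storey term at the top slot plus the level-`0` storey term lifted once. -/
theorem compVHKer_unroll_two (μ : Fin (d + 1)) (y : Site (d + 1)) (f f' : Bond (d + 1)) :
    compVHKer ℓ 𝓋 L 2 μ y f f'
      = (∑ κ : Fin (d + 1), ∑ e ∈ offs L, ℓ 1 μ y (κ, (L : ℤ) • y + e) * storeyVH ℓ 𝓋 L 0 κ ((L : ℤ) • y + e) f f')
        + storeyVH ℓ 𝓋 L 1 μ y f f' := by
  rw [compVHKer_unroll, Finset.sum_range_succ, Finset.sum_range_one]
  simp only [show (2 : ℕ) - 1 - 0 = 1 from rfl, show (2 : ℕ) - 1 - 1 = 0 from rfl, liftUp_zero, liftUp_one, zero_add]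

/-! ## §3 The packed field–field constraint Hessian table (F6a) unrolled -/

/-- [folklore] **F6a's COMPOSITE CONSTRAINT-HESSIAN TABLE UNROLLED BY STOREY**: `compHessFF ℓ 𝒽 L m = packFF (the unrolled kernel)` — the `H` member of
`tabsComp` (hence the Λ word `SLam N (lamCoeffOf (KInv N) N) (compH …)` of the composite level-0 stencil) is the storey sum of one constraint-Hessian brick per
storey along transported legs, lifted to the top slot. -/
theorem compHessFF_unroll (𝒽 : ℕ → Fin (d + 1) → Site (d + 1) → Bond (d + 1) → Bond (d + 1) → ℝ) (m : ℕ) :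
    compHessFF ℓ 𝒽 L m
      = packFF (fun μ y f f' => ∑ k ∈ range m, liftUp ℓ L k (fun μ' y' => storeyVH ℓ 𝒽 L k μ' y' f f') (m - 1 - k) μ y) := by
  unfold compHessFF
  congr 1
  funext μ y f f'
  exact compVHKer_unroll m μ y f f'

/-- [folklore] pointwise form of `compHessFF_unroll` on the field–field block (`packFF`'s `inl`–`inl` entries). -/
theorem compHessFF_unroll_apply (𝒽 : ℕ → Fin (d + 1) → Site (d + 1) → Bond (d + 1) → Bond (d + 1) → ℝ) (m : ℕ)
    (μ : Fin (d + 1)) (y x x' : Site (d + 1)) (a b : Fib d) :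
    compHessFF ℓ 𝒽 L m μ y x x' a b
      = packFF (fun μ y f f' => ∑ k ∈ range m, liftUp ℓ L k (fun μ' y' => storeyVH ℓ 𝒽 L k μ' y' f f') (m - 1 - k) μ y) μ y x x' a b := by
  rw [compHessFF_unroll]

end Summit.QuantumFields.BalabanUV.Beta.CompositeVertexKernelUnroll

end
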